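import Summits.RiemannHypothesis.RiemannHypothesis.Theorems.PfPersistencePerronFakeNodelessFold
import HarnessLib

/-!
# PF persistence — PERRON-FAKE (S6), part 2/3: JENTZSCH'S CRITERION (form-domain version) for the full
# windowed form of an arbitrary weight table; the one-signedness dichotomy; the even polar channel;
# the ζ instance

`pub-rhpf` cell, unit `pub-rhpf-prover-perron` (S6; CASE-DAG §6 row PERRON-FAKE; node G1.PERRON).
**Mechanism / rigidity campaign; no RH claims.**  RH-free: Mathlib + proved tree files only; this
part declares NO definitions — every hypothesis is spelled out (the source `S` of a state enters as a
function with the hypothesis `hS : ∀ y, S y = …`; "form-domain ground state" enters as the three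
hypotheses `coreAdm a U`, `∫‖U‖² = 1`, minimality of the Rayleigh quotient over the class).  The named
objects (`tableSource`, `IsTableGround`, `PerronSourceDominated`, `AeOneSigned`, …), the overview,
the honesty theorem and the references are in part 3, `PfPersistencePerronFakeNodeless`.

Notation of the docstrings: window `a`, real table `w`, `Q^w_a = tableClosedForm a w`, class
`coreAdm a`, `u⁺ = max(u,0)`, `u⁻ = max(−u,0)`, table source
`S^w_u(y) = ∫_{(0,∞)} ρ(t)(u⁺(y+t)+u⁺(y−t)) dt + Σ_{log n<2a} w(n)(u⁺(y+log n)+u⁺(y−log n))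
− 2∫u⁺(x)cosh((x−y)/2) dx`.

PROVED here:
* `ae_nonneg_of_source_pos` — **Jentzsch's criterion for every table and every window**: if folding
  does not lower the form (`Q^w_a(u) ≤ Q^w_a(|u|)`) and `S^w_u > 0` a.e. on `{u < 0}`, then `u ≥ 0`
  a.e. (from the lobe-balance law of part 1: `∫u⁻S^w_u ≤ 0` with a non-negative integrand).  No
  Euler–Lagrange equation, no coercivity constant, no truncation of `ρ`, no Beurling–Deny property of
  the full form (PROVED false for `a ≥ 3/10` in the tree, `sw_not_signImproving_of_ge`).
* `fold_le_of_minimal`, `fold_le_of_evenMinimal` — a (resp. an even-sector) form-domain ground state is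
  not lowered by folding; `tableClosedForm_neg_fun`, `coreAdm_neg_fun` — the `±u` symmetry.
* `aeOneSigned_of_minimal_of_sources`, `aeOneSigned_of_evenMinimal_of_sources` — **dichotomy**: a real
  (even-sector) ground state with `S^w_u > 0` a.e. on `{u<0}` OR `S^w_{−u} > 0` a.e. on `{u>0}` is a.e.
  one-signed; `frequently_source_nonpos_of_minimal` — **where a node must sit**: a real ground state
  that is not a.e. one-signed has `S^w_u ≤ 0` on a non-null part of `{u<0}` AND `S^w_{−u} ≤ 0` on a
  non-null part of `{u>0}`.
* `integral_posPart_mul_cosh_of_even` — the **even polar channel**: for even `u`,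
  `∫u⁺(x)cosh((x−y)/2) dx = cosh(y/2)∫u⁺(x)cosh(x/2) dx` (the `sinh`-moment of an even function
  vanishes): in the even sector the repulsion is the single rank-one channel `cosh(·/2)`.
* `zeta_minimal_of_isWeilGroundState`, `zeta_minimal_weilTrunc` — **the ζ instance**: a ground state
  of the windowed Weil form (`IsWeilGroundState`, the tree's `L²`-limit notion; its open-window
  truncation `weilTrunc a u`) satisfies the three form-domain ground-state hypotheses for ζ's table
  `zetaTable = Λ(n)n^{-1/2}` (`tableClosedForm a zetaTable = weilClosedForm a`), by the landed
  form-domain theorems `stub_groundStateEnergy` / `stub_formDomainPos` of route WeilWindowFlow.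
-/

set_option linter.dupNamespace false

noncomputable section

open MeasureTheory Set Filter Complex
open scoped Real Topology

namespace Summit.RiemannHypothesis.RiemannHypothesis.Theorems.PfPersistence

open Literature.NumberTheory.LFunctions
open Summit.RiemannHypothesis.RiemannHypothesis.Theorems.WeilGroundStateMarkovPart
open Summit.RiemannHypothesis.RiemannHypothesis.Theorems.PolarPerronFrobenius

/-! ## §1 The `±u` symmetry of the full form and of the class -/

section Neg

/-- `D_t(−U) = D_t(U)`. [folklore] -/
theorem weilIncrement_neg_fun (U : ℝ → ℂ) (t : ℝ) :
    weilIncrement (fun x ↦ -U x) t = weilIncrement U t := by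
  unfold weilIncrement
  refine integral_congr_ae (Eventually.of_forall fun x ↦ ?_)
  simp only
  rw [show -U (x + t) - -U x = -(U (x + t) - U x) by ring, norm_neg]

/-- `P(−U) = P(U)`. [folklore] -/
theorem weilPoleForm_neg_fun (U : ℝ → ℂ) : weilPoleForm (fun x ↦ -U x) = weilPoleForm U := by
  unfold weilPoleForm
  have h1 : ∫ t : ℝ, -U t * (Real.cosh (t / 2) : ℂ) = -∫ t : ℝ, U t * (Real.cosh (t / 2) : ℂ) := by
    rw [← integral_neg]
    exact integral_congr_ae (Eventually.of_forall fun t ↦ by simp only; ring)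
  have h2 : ∫ t : ℝ, -U t * (Real.sinh (t / 2) : ℂ) = -∫ t : ℝ, U t * (Real.sinh (t / 2) : ℂ) := by
    rw [← integral_neg]
    exact integral_congr_ae (Eventually.of_forall fun t ↦ by simp only; ring)
  rw [h1, h2, norm_neg, norm_neg]

/-- `𝓔^w_a(−U) = 𝓔^w_a(U)`. [folklore] -/
theorem tableDirichletEnergy_neg_fun (a : ℝ) (w : ℕ → ℝ) (U : ℝ → ℂ) :
    tableDirichletEnergy a w (fun x ↦ -U x) = tableDirichletEnergy a w U := by
  unfold tableDirichletEnergy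
  simp only [weilIncrement_neg_fun]

/-- `Q^w_a(−U) = Q^w_a(U)`. [folklore] -/
theorem tableClosedForm_neg_fun (a : ℝ) (w : ℕ → ℝ) (U : ℝ → ℂ) :
    tableClosedForm a w (fun x ↦ -U x) = tableClosedForm a w U := by
  unfold tableClosedForm
  rw [weilPoleForm_neg_fun, tableDirichletEnergy_neg_fun]
  simp only [norm_neg]

/-- The class `coreAdm a` is closed under negation. [folklore] -/
theorem coreAdm_neg_fun {a : ℝ} {U : ℝ → ℂ} (hU : coreAdm a U) : coreAdm a (fun x ↦ -U x) := by
  have h := hU.const_mul (-1)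
  have e : (fun x ↦ (-1 : ℂ) * U x) = fun x ↦ -U x := by funext x; ring
  rwa [e] at h

end Neg

/-! ## §2 Jentzsch's criterion, form-domain version -/

section Criterion

variable {a : ℝ} {u : ℝ → ℝ}

/-- **Jentzsch / Perron–Frobenius source criterion for the FULL windowed form of a table (PROVED).**
If folding does not lower the form (`Q^w_a(u) ≤ Q^w_a(|u|)`; e.g. `u` is a form-domain ground state,
`fold_le_of_minimal`) and the table source `S = S^w_u` is positive a.e. on `{u < 0}`, then `u ≥ 0` a.e.
(ζ with `IsWeilGroundState`: the tree's `swg_ae_nonneg_of_source_pos`.) [folklore] -/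
theorem ae_nonneg_of_source_pos (w : ℕ → ℝ) (hum : Measurable u)
    (hU : coreAdm a (fun x ↦ ((u x : ℝ) : ℂ)))
    (hfold : tableClosedForm a w (fun x ↦ ((u x : ℝ) : ℂ)) ≤
      tableClosedForm a w (fun x ↦ ((|u x| : ℝ) : ℂ)))
    (S : ℝ → ℝ)
    (hS : ∀ y, S y =
      (∫ t in Ioi (0 : ℝ), weilArchDensity t * (max (u (y + t)) 0 + max (u (y - t)) 0)) +
        (∑ n ∈ weilPrimeIndex a, w n * (max (u (y + Real.log n)) 0 + max (u (y - Real.log n)) 0)) -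
        2 * ∫ x, max (u x) 0 * Real.cosh ((x - y) / 2))
    (hsrc : ∀ᵐ y : ℝ, u y < 0 → 0 < S y) :
    ∀ᵐ y : ℝ, 0 ≤ u y := by
  obtain ⟨hid, hInS⟩ := tableClosedForm_abs_sub_eq_source w hum hU S hS
  -- the fold inequality: `∫ u⁻ S ≤ 0`
  have hle : ∫ y, max (-u y) 0 * S y ≤ 0 := by linarith
  -- non-negativity of the integrand, hence `u⁻ S = 0` a.e.
  have hnn : 0 ≤ᵐ[volume] fun y ↦ max (-u y) 0 * S y := by
    filter_upwards [hsrc] with y hy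
    by_cases huy : u y < 0
    · exact mul_nonneg (le_max_right _ _) (hy huy).le
    · simp only [Pi.zero_apply]; rw [max_eq_right (by linarith), zero_mul]
  have hzero : (fun y ↦ max (-u y) 0 * S y) =ᵐ[volume] 0 :=
    (integral_eq_zero_iff_of_nonneg_ae hnn hInS).1 (le_antisymm hle (integral_nonneg_of_ae hnn))
  filter_upwards [hzero, hsrc] with y hy0 hy
  by_contra hneg
  have huy : u y < 0 := lt_of_not_ge hneg
  have hSy : 0 < S y := hy huy
  have hn : 0 < max (-u y) 0 := by rw [max_eq_left (by linarith)]; linarith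
  have : max (-u y) 0 * S y = 0 := hy0
  nlinarith

/-- A form-domain ground state (normalised minimiser of the Rayleigh quotient of `Q^w_a` over the class)
is not lowered by folding: `Q(U) ≤ Q(|U|)`. [folklore] -/
theorem fold_le_of_minimal {w : ℕ → ℝ} {U : ℝ → ℂ} (hU : coreAdm a U)
    (hN : ∫ x, ‖U x‖ ^ 2 = (1 : ℝ))
    (hmin : ∀ v : ℝ → ℂ, coreAdm a v →
      tableClosedForm a w U * (∫ x, ‖v x‖ ^ 2) ≤ tableClosedForm a w v) :
    tableClosedForm a w U ≤ tableClosedForm a w (fun x ↦ ((‖U x‖ : ℝ) : ℂ)) := by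
  have hN' : ∫ x, ‖((‖U x‖ : ℝ) : ℂ)‖ ^ 2 = ∫ x, ‖U x‖ ^ 2 :=
    integral_congr_ae (Eventually.of_forall fun x ↦ by simp)
  have h := hmin _ hU.norm
  rw [hN', hN, mul_one] at h
  exact h

/-- An EVEN-sector form-domain ground state (minimiser among the even members of the class) is not
lowered by folding (`|U|` is even and in the class). [folklore] -/
theorem fold_le_of_evenMinimal {w : ℕ → ℝ} {U : ℝ → ℂ} (hU : coreAdm a U) (he : ∀ x, U (-x) = U x)
    (hN : ∫ x, ‖U x‖ ^ 2 = (1 : ℝ))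
    (hmin : ∀ v : ℝ → ℂ, coreAdm a v → (∀ x, v (-x) = v x) →
      tableClosedForm a w U * (∫ x, ‖v x‖ ^ 2) ≤ tableClosedForm a w v) :
    tableClosedForm a w U ≤ tableClosedForm a w (fun x ↦ ((‖U x‖ : ℝ) : ℂ)) := by
  have hN' : ∫ x, ‖((‖U x‖ : ℝ) : ℂ)‖ ^ 2 = ∫ x, ‖U x‖ ^ 2 :=
    integral_congr_ae (Eventually.of_forall fun x ↦ by simp)
  have h := hmin _ hU.norm (fun x ↦ by simp only [he x])
  rw [hN', hN, mul_one] at h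
  exact h

/-- **Dichotomy (PROVED).**  A real state that folds up (`Q(u) ≤ Q(|u|)`, which is symmetric in `±u`)
with `S^w_u > 0` a.e. on `{u < 0}` OR `S^w_{−u} > 0` a.e. on `{u > 0}` is a.e. one-signed. [folklore] -/
theorem aeOneSigned_of_fold_le_of_sources (w : ℕ → ℝ) (hum : Measurable u)
    (hU : coreAdm a (fun x ↦ ((u x : ℝ) : ℂ)))
    (hfold : tableClosedForm a w (fun x ↦ ((u x : ℝ) : ℂ)) ≤
      tableClosedForm a w (fun x ↦ ((|u x| : ℝ) : ℂ)))
    (Sp Sm : ℝ → ℝ)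
    (hSp : ∀ y, Sp y =
      (∫ t in Ioi (0 : ℝ), weilArchDensity t * (max (u (y + t)) 0 + max (u (y - t)) 0)) +
        (∑ n ∈ weilPrimeIndex a, w n * (max (u (y + Real.log n)) 0 + max (u (y - Real.log n)) 0)) -
        2 * ∫ x, max (u x) 0 * Real.cosh ((x - y) / 2))
    (hSm : ∀ y, Sm y =
      (∫ t in Ioi (0 : ℝ), weilArchDensity t * (max (-u (y + t)) 0 + max (-u (y - t)) 0)) +
        (∑ n ∈ weilPrimeIndex a, w n *
          (max (-u (y + Real.log n)) 0 + max (-u (y - Real.log n)) 0)) -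
        2 * ∫ x, max (-u x) 0 * Real.cosh ((x - y) / 2))
    (h : (∀ᵐ y : ℝ, u y < 0 → 0 < Sp y) ∨ (∀ᵐ y : ℝ, 0 < u y → 0 < Sm y)) :
    (∀ᵐ y : ℝ, 0 ≤ u y) ∨ (∀ᵐ y : ℝ, u y ≤ 0) := by
  rcases h with hs | hs
  · exact Or.inl (ae_nonneg_of_source_pos w hum hU hfold Sp hSp hs)
  · right
    have hUn : coreAdm a (fun x ↦ (((-u x : ℝ)) : ℂ)) := by
      have h1 := coreAdm_neg_fun hU
      have e : (fun x ↦ -((u x : ℝ) : ℂ)) = fun x ↦ (((-u x : ℝ)) : ℂ) := by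
        funext x; push_cast; ring
      rwa [e] at h1
    have hfoldn : tableClosedForm a w (fun x ↦ (((-u x : ℝ)) : ℂ)) ≤
        tableClosedForm a w (fun x ↦ ((|(-u x)| : ℝ) : ℂ)) := by
      have e1 : (fun x ↦ (((-u x : ℝ)) : ℂ)) = fun x ↦ -((u x : ℝ) : ℂ) := by
        funext x; push_cast; ring
      have e2 : (fun x ↦ ((|(-u x)| : ℝ) : ℂ)) = fun x ↦ ((|u x| : ℝ) : ℂ) := by
        funext x; rw [abs_neg]
      rw [e1, e2, tableClosedForm_neg_fun]
      exact hfold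
    have hs' : ∀ᵐ y : ℝ, (fun x ↦ -u x) y < 0 → 0 < Sm y := by
      filter_upwards [hs] with y hy hlt
      exact hy (by simpa using hlt)
    have h2 := ae_nonneg_of_source_pos (u := fun x ↦ -u x) w hum.neg hUn hfoldn Sm hSm hs'
    filter_upwards [h2] with y hy
    simpa using hy

/-- **Where a node must sit (PROVED; the criterion in obstruction form).**  A real state that folds up
(`Q(u) ≤ Q(|u|)`, e.g. any real or real even-sector form-domain ground state) and is NOT a.e.
one-signed has `S^w_u ≤ 0` on a non-null part of `{u < 0}` AND `S^w_{−u} ≤ 0` on a non-null part of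
`{u > 0}`: each lobe contains a non-null region where the polar repulsion of the other lobe beats its
Markov attraction. [folklore] -/
theorem frequently_source_nonpos_of_fold_le (w : ℕ → ℝ) (hum : Measurable u)
    (hU : coreAdm a (fun x ↦ ((u x : ℝ) : ℂ)))
    (hfold : tableClosedForm a w (fun x ↦ ((u x : ℝ) : ℂ)) ≤
      tableClosedForm a w (fun x ↦ ((|u x| : ℝ) : ℂ)))
    (Sp Sm : ℝ → ℝ)
    (hSp : ∀ y, Sp y =
      (∫ t in Ioi (0 : ℝ), weilArchDensity t * (max (u (y + t)) 0 + max (u (y - t)) 0)) +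
        (∑ n ∈ weilPrimeIndex a, w n * (max (u (y + Real.log n)) 0 + max (u (y - Real.log n)) 0)) -
        2 * ∫ x, max (u x) 0 * Real.cosh ((x - y) / 2))
    (hSm : ∀ y, Sm y =
      (∫ t in Ioi (0 : ℝ), weilArchDensity t * (max (-u (y + t)) 0 + max (-u (y - t)) 0)) +
        (∑ n ∈ weilPrimeIndex a, w n *
          (max (-u (y + Real.log n)) 0 + max (-u (y - Real.log n)) 0)) -
        2 * ∫ x, max (-u x) 0 * Real.cosh ((x - y) / 2))
    (hn : ¬((∀ᵐ y : ℝ, 0 ≤ u y) ∨ (∀ᵐ y : ℝ, u y ≤ 0))) :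
    (∃ᵐ y : ℝ, u y < 0 ∧ Sp y ≤ 0) ∧ ∃ᵐ y : ℝ, 0 < u y ∧ Sm y ≤ 0 := by
  constructor
  · rw [Filter.Frequently]
    intro hcon
    refine hn (aeOneSigned_of_fold_le_of_sources w hum hU hfold Sp Sm hSp hSm (Or.inl ?_))
    filter_upwards [hcon] with y hy hlt
    by_contra hle
    exact hy ⟨hlt, not_lt.1 hle⟩
  · rw [Filter.Frequently]
    intro hcon
    refine hn (aeOneSigned_of_fold_le_of_sources w hum hU hfold Sp Sm hSp hSm (Or.inr ?_))
    filter_upwards [hcon] with y hy hlt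
    by_contra hle
    exact hy ⟨hlt, not_lt.1 hle⟩

end Criterion

/-! ## §3 The even polar channel -/

section Even

variable {a : ℝ} {u : ℝ → ℝ}

/-- **The polar part of the source of an EVEN state** factors through the single moment
`⟨u⁺, cosh(·/2)⟩`: `∫u⁺(x)cosh((x−y)/2) dx = cosh(y/2)·∫u⁺(x)cosh(x/2) dx` (the `sinh`-moment of an
even function vanishes). [folklore] -/
theorem integral_posPart_mul_cosh_of_even (hu2 : MemLp u 2 volume)
    (hus : ∀ᵐ x : ℝ, x ∉ Icc (-a) a → u x = 0) (he : ∀ x, u (-x) = u x) (y : ℝ) :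
    ∫ x, max (u x) 0 * Real.cosh ((x - y) / 2) =
      Real.cosh (y / 2) * ∫ x, max (u x) 0 * Real.cosh (x / 2) := by
  have hcosh : Continuous fun t : ℝ ↦ Real.cosh (t / 2) :=
    Real.continuous_cosh.comp (continuous_id.div_const 2)
  have hsinh : Continuous fun t : ℝ ↦ Real.sinh (t / 2) :=
    Real.continuous_sinh.comp (continuous_id.div_const 2)
  have hp2 := swg_memLp_posPart hu2
  have hpi : Integrable fun x ↦ max (u x) 0 := swg_integrable_of_memLp hp2 (swg_posPart_ae_zero hus)
  have ipc := swg_integrable_mul_continuous hpi (swg_posPart_ae_zero hus) hcosh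
  have ips := swg_integrable_mul_continuous hpi (swg_posPart_ae_zero hus) hsinh
  have key : ∫ x, max (u x) 0 * Real.cosh ((x - y) / 2) =
      Real.cosh (y / 2) * (∫ x, max (u x) 0 * Real.cosh (x / 2)) -
        Real.sinh (y / 2) * ∫ x, max (u x) 0 * Real.sinh (x / 2) := by
    have hpt : ∀ x, max (u x) 0 * Real.cosh ((x - y) / 2) =
        Real.cosh (y / 2) * (max (u x) 0 * Real.cosh (x / 2)) -
          Real.sinh (y / 2) * (max (u x) 0 * Real.sinh (x / 2)) := by
      intro x; rw [show (x - y) / 2 = x / 2 - y / 2 by ring, Real.cosh_sub]; ring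
    simp_rw [hpt]
    rw [integral_sub (ipc.const_mul _) (ips.const_mul _), integral_const_mul, integral_const_mul]
  have hodd : ∫ x, max (u x) 0 * Real.sinh (x / 2) = 0 := by
    have h := integral_neg_eq_self (fun x ↦ max (u x) 0 * Real.sinh (x / 2)) volume
    have e : (fun x ↦ max (u (-x)) 0 * Real.sinh (-x / 2)) =
        fun x ↦ -(max (u x) 0 * Real.sinh (x / 2)) := by
      funext x
      rw [he x, show -x / 2 = -(x / 2) by ring, Real.sinh_neg]
      ring
    rw [e, integral_neg] at h
    linarith
  rw [key, hodd, mul_zero, sub_zero]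

end Even

/-! ## §4 The ζ instance -/

section Zeta

open Summit.RiemannHypothesis.RiemannHypothesis.Theorems.WeilWindowFlowWindowLipschitz
  (stub_groundStateEnergy stub_formDomainPos)
open Summit.RiemannHypothesis.RiemannHypothesis.Theorems.PfPersistenceDownCone (zetaTable)

variable {a : ℝ}

/-- **The form-domain ground-state hypotheses are the tree's notion for ζ (PROVED)**: a ground state of
the windowed Weil form (`IsWeilGroundState a U`) vanishing pointwise off `[-a, a]` lies in the class,
is normalised, and minimises the Rayleigh quotient of the full closed form of ζ's table
(`tableClosedForm a zetaTable = weilClosedForm a`) over the class — by the landed form-domain theorems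
`stub_groundStateEnergy` / `stub_formDomainPos` (route WeilWindowFlow). [folklore] -/
theorem zeta_minimal_of_isWeilGroundState (ha : 0 < a) {U : ℝ → ℂ} (hU : IsWeilGroundState a U)
    (hUs : ∀ x, x ∉ Icc (-a) a → U x = 0) :
    coreAdm a U ∧ (∫ x, ‖U x‖ ^ 2 = (1 : ℝ)) ∧
      ∀ v : ℝ → ℂ, coreAdm a v →
        tableClosedForm a zetaTable U * (∫ x, ‖v x‖ ^ 2) ≤ tableClosedForm a zetaTable v := by
  obtain ⟨hE, hC2⟩ := stub_groundStateEnergy a U hU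
  have hN : ∫ x, ‖U x‖ ^ 2 = (1 : ℝ) := hU.integral_norm_sq
  refine ⟨⟨hU.memLp, hUs, hE⟩, hN, fun v hv ↦ ?_⟩
  have hC1 := stub_formDomainPos a ha v hv.1 (Eventually.of_forall hv.2.1) hv.2.2
  have hNv : 0 ≤ ∫ x, ‖v x‖ ^ 2 := integral_nonneg fun x ↦ by positivity
  rw [PfPersistence.tableClosedForm_zetaTable, PfPersistence.tableClosedForm_zetaTable]
  unfold weilClosedForm
  rw [hN] at hC2 ⊢
  have h3 : (weilPoleForm U + weilDirichletEnergy a U - weilMarkovConstant a * 1) * ∫ x, ‖v x‖ ^ 2 ≤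
      weilGroundEnergy a * ∫ x, ‖v x‖ ^ 2 :=
    mul_le_mul_of_nonneg_right (by linarith) hNv
  linarith

/-- **ζ carries form-domain ground states wherever it carries ground states (PROVED)**: the open-window
truncation `weilTrunc a u` of any ground state `u` of the windowed Weil form satisfies the three
form-domain ground-state hypotheses for ζ's table. [folklore] -/
theorem zeta_minimal_weilTrunc (ha : 0 < a) {u : ℝ → ℂ} (hu : IsWeilGroundState a u) :
    coreAdm a (weilTrunc a u) ∧ (∫ x, ‖weilTrunc a u x‖ ^ 2 = (1 : ℝ)) ∧
      ∀ v : ℝ → ℂ, coreAdm a v →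
        tableClosedForm a zetaTable (weilTrunc a u) * (∫ x, ‖v x‖ ^ 2) ≤
          tableClosedForm a zetaTable v :=
  zeta_minimal_of_isWeilGroundState ha (isWeilGroundState_weilTrunc hu) fun x hx ↦
    weilTrunc_eq_zero u (by
      rcases not_and_or.1 (fun h ↦ hx ⟨h.1, h.2⟩ : ¬(-a ≤ x ∧ x ≤ a)) with h | h
      · exact le_abs.2 (Or.inr (by linarith [lt_of_not_ge h]))
      · exact le_abs.2 (Or.inl (lt_of_not_ge h).le))

end Zeta

end Summit.RiemannHypothesis.RiemannHypothesis.Theorems.PfPersistence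

end
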